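import Summits.BirchSwinnertonDyer.Rank1Residual.Additive.SelectorIdentityTameThreeProofs
import Summits.BirchSwinnertonDyer.Rank1Residual.Additive.KodairaDictionaryThree
import Literature.NumberTheory.EllipticCurves.OggFormulaTypeIIIProofs
import HarnessLib

/-!
# The SELECTOR IDENTITY on the tame potentially supersingular cell at `3` is a THEOREM:
# `Additive.SelectorIdentityTameThree` UNCONDITIONALLY, from Tate's algorithm (types III / III*) and
# L-O56-sel — the Table II binder of `SelectorIdentityTameThreeProofs` retired
# (cell `b2b-bsdres`; seat `b2b-bsdres-x11b3-p7` GEN 7 as CROSS-CELL POOL HAND — cc-typer-5 GEN 8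
#  "the STRETCH is welcome", INBOX 2026-08-21T17:57Z; theorems only)

HONEST FRAMING (cell `b2b-bsdres`, run/shared/lean/b2b/bsd-rank1-residual/, verbatim in every file): the
goal of the cell is to DELETE the COMBINATION-SHAPED residual classes of the Birch–Swinnerton-Dyer formula
for ALL analytic-rank `≤ 1` elliptic curves over `ℚ` — "full BSD formula for every rank `≤ 1` curve in
class `C`" assembled STRICTLY from published theorems — so that the rank-`≤ 1` remainder becomes exactly
the CONSTRUCTION-SHAPED classes, which are TYPED (missing-input `Prop`s), NOT attempted. This is not
"finishing BSD". Lane CLASS-CLOSURE / teams o5–o6 (O5 OPEN): research routes; census output is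
EVIDENCE, never a Literature fact; nothing is booked; no mark of `RESIDUAL-MAP.md` moves. This file:
THEOREMS ONLY (no definition, no named fact, no `@[conjecture]` node, no `sorry`; net named-fact debt
`0`); NO hypothesis beyond the TARGET's own binders — in particular NO Table II fact.

## What is proved

* **`selectorIdentityTameThree_holds : SelectorIdentityTameThree`** — cc-typer-5 GEN 3's TARGET
  (`Additive/LocIrrValuationCriterionThree.lean`; EVIDENCE 36 323 / 0, kit j124555): for every elliptic,
  globally minimal `W/ℚ` with `ClassO5 W 3`, `SubTprime W 3`, `j ≠ 1728`,
  `LocIrr W 3 ↔ 7 ≤ v₃(j − 1728)`; via **`locIrr_three_iff_seven_le_of_subTprime`** (`Addv W 3`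
  instead of `ClassO5`) and **`padicValRat_j_sub_eq_three_or_seven_le_of_kodairaSymbolAt_III_or_IIIstar`**
  — Kodaira `III`/`III*` at `3` ⟹ `v₃(j − 1728) = 3 ∨ 7 ≤ v₃(j − 1728)` (o5-r1's census gap "never
  `4, 5, 6`", now table-free); with `padicValRat_Δ_eq_of_kodairaSymbolAt_III_or_IIIstar`
  (`v₃Δ_min = 3 / 9`) and the `3`-adic reading of `c₄³ = c₆² + 1728Δ` (`padicValRat_c_relation_three`).
* §1 **`valued_j_sub_eq_or_le_of_b_shape`** — THE BRACKET LEMMA (any Dedekind domain, place `v`,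
  uniformiser `π` with `π = 3` in `K_v`): on a `K_v`-model with `b₂ = π^{k₂}β₂`, `b₄ = π^{k₄}β₄`,
  `b₆ = π^{k₆}β₆`, `Δ = π^e δ` (`βᵢ ∈ 𝒪_v`, `δ` a unit), `(k₂,k₄,k₆;m) = (1,1,2;3)` [III] or
  `(2,3,5;6)` [III*]: `c₆ = π^m·(−β₂³ + π·4β₂β₄ − π²·8β₆)` (`36 = 4π²`, `216 = 8π³`), the bracket a
  UNIT if `β₂` is and in `π²𝒪_v` otherwise, so `ord c₆ ∈ {m} ∪ [m+2, ∞)` — NEVER `4` on III, NEVER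
  `7` on III*; through the INVARIANT `j − 1728 = c₆²/Δ` (`j_sub_eq_c₆_sq_div_Δ_of_field`, Mathlib
  `variableChange_j`): `v(j − 1728) = exp(e − 2m)` or `≤ exp(e − 2m − 4)` (`exp(−3)` / `≤ exp(−7)`).

Inputs, all TREE THEOREMS: Tate's Step-4 / Step-9 normal forms at `v ∤ 2`
(`exists_variableChange_b_of_kodairaSymbolAt_eq_III` / `_eq_IIIstar`, `OggFormulaTypeIIIProofs`,
bsd.S15); (t′) ⟺ `III`/`III*` (`subTprime_three_iff_kodairaSymbolAt_III_or_IIIstar`,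
`KodairaDictionaryThree`, n1011-p14); `ord Δ_min = m + 1`
(`ordMinimalDiscriminant_eq_numComponentsAt_add_one_of_kodairaSymbolAt`); L-O56-sel
(`locIrrThreeIffCriterion_holds`, harvest-2 E89); the `j`/valuation helpers of p297328. The two WILD
rows with `v₃(j − 1728) = 5` ((2,4,3) = II, (4,7,9) = IV*; harvest-2's NB, E89 §4) have
`ord c₆ = m + 1`, which the bracket lemma forbids on III / III*: the TYPE excludes them, no table.
Effect: `MazurTateGrowthDichotomyThree`'s bridges take `hsel := selectorIdentityTameThree_holds`;
`selectorIdentityTameThree_of_tableII` (p297328) stays as landed, superseded for this identity.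
WORDING (EVIDENCE framing; cc-typer-5 / the o5–o6 planners rule on `TYPED.md` / `TARGETS.md`):
"SELECTOR IDENTITY on O5b is a THEOREM: L-O56-sel + Tate's algorithm Steps 4/9 at `3` + the
(t′) ⟺ III/III* dictionary; the Table II binder is RETIRED for this identity; census 36 323 / 0 stays
EVIDENCE; nothing booked; no mark." NOT here: `j = 1728` (there `LocIrr` holds by
`locIrr_three_of_c₆_eq_zero'`, the selector `v₃(0)` is junk); the wild cell (w); any census.

References: J. H. Silverman, *Advanced Topics in the Arithmetic of Elliptic Curves*, GTM 151 (1994),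
IV.9.4 Steps 4, 9, Table 4.1, proof of IV.11.1 for `p = 3` [SilvermanATAEC1994]; A. Kraus,
Manuscripta Math. 69 (1990) 353–385; O. Fouquet, X. Wan, arXiv:2107.13726 Thm 5.1 [FouquetWan2021].
-/

noncomputable section

open scoped Classical

open WeierstrassCurve IsDedekindDomain IsDedekindDomain.HeightOneSpectrum WithZero Rat.HeightOneSpectrum
  Literature.NumberTheory.EllipticCurves Literature.NumberTheory.EllipticCurves.Rank1Residual
  Literature.NumberTheory.EllipticCurves.Rank1Residual.Typed Literature.NumberTheory.DiophantineGeometry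

namespace Summit.BirchSwinnertonDyer.Rank1Residual.Additive

/-! ## §1 Local algebra on a `K_v`-model with the III / III* shapes of `b₂, b₄, b₆, Δ` -/

section Local

/-- `j − 1728 = c₆² / Δ` over any field (`1728 Δ = c₄³ − c₆²`). [folklore] -/
theorem j_sub_eq_c₆_sq_div_Δ_of_field {F : Type*} [Field F] (X : WeierstrassCurve F)
    [X.IsElliptic] : X.j - 1728 = X.c₆ ^ 2 / X.Δ := by
  have hΔ : X.Δ ≠ 0 := by rw [← X.coe_Δ']; exact X.Δ'.ne_zero
  rw [WeierstrassCurve.j, Units.val_inv_eq_inv_val, X.coe_Δ', eq_div_iff hΔ]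
  have := X.c_relation
  field_simp
  linear_combination -this

/-- In `ℤᵐ⁰`: strictly below `1 = exp 0` means at most `exp (−1)`. [folklore] -/
private theorem le_exp_neg_one_of_lt_one {x : ℤᵐ⁰} (hx : x < 1) : x ≤ exp (-1 : ℤ) := by
  rcases eq_or_ne x 0 with rfl | h0
  · simp
  · rw [← exp_log h0, ← exp_zero, exp_lt_exp] at hx
    rw [← exp_log h0, exp_le_exp]; omega

variable {A : Type*} [CommRing A] [IsDedekindDomain A] {K : Type*} [Field K] [Algebra A K]
  [IsFractionRing A K] (v : HeightOneSpectrum A)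

/-- **The bracket lemma at a place `v` with `π = 3` a uniformiser** (residue characteristic `3`).
On a `K_v`-model whose `b₂ = π^{k₂}β₂`, `b₄ = π^{k₄}β₄`, `b₆ = π^{k₆}β₆`, `Δ = π^{e}δ`
(`βᵢ ∈ 𝒪_v`, `δ ∈ 𝒪_v^×`) with `(k₂,k₄,k₆;m) = (1,1,2;3)` (type III) or `(2,3,5;6)` (type III*):
`c₆ = −b₂³ + 36b₂b₄ − 216b₆ = π^m·(−β₂³ + π·4β₂β₄ − π²·8β₆)` (`36 = 4π²`, `216 = 8π³`), the bracket
being a UNIT if `β₂` is and in `π²𝒪_v` otherwise; hence through the invariant `j − 1728 = c₆²/Δ`: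
`v(j − 1728) = exp(e − 2m)` or `v(j − 1728) ≤ exp(e − 2m − 4)`.
[cite: SilvermanATAEC1994, IV.9.4 Steps 4 and 9 (normal forms of III, III*)] -/
theorem valued_j_sub_eq_or_le_of_b_shape {π : K} (hπ : v.valuation K π = exp (-1 : ℤ))
    (h3 : (π : v.adicCompletion K) = 3) (N : WeierstrassCurve (v.adicCompletion K)) [N.IsElliptic]
    {k₂ k₄ k₆ m : ℕ} (e : ℕ) (β₂ β₄ β₆ δ : v.adicCompletionIntegers K) (hδ : IsUnit δ)
    (hb₂ : N.b₂ = (π : v.adicCompletion K) ^ k₂ * β₂)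
    (hb₄ : N.b₄ = (π : v.adicCompletion K) ^ k₄ * β₄)
    (hb₆ : N.b₆ = (π : v.adicCompletion K) ^ k₆ * β₆)
    (hΔ : N.Δ = (π : v.adicCompletion K) ^ e * δ)
    (hk : (k₂ = 1 ∧ k₄ = 1 ∧ k₆ = 2 ∧ m = 3) ∨ (k₂ = 2 ∧ k₄ = 3 ∧ k₆ = 5 ∧ m = 6)) :
    Valued.v (N.j - 1728) = exp ((e : ℤ) - 2 * m) ∨
      Valued.v (N.j - 1728) ≤ exp ((e : ℤ) - 2 * m - 4) := by
  set w : Valuation (v.adicCompletion K) ℤᵐ⁰ := Valued.v with hw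
  set ϖ : v.adicCompletion K := (π : v.adicCompletion K) with hϖ
  have hπv : w ϖ = exp (-1 : ℤ) := by rw [hw, hϖ, valuedAdicCompletion_eq_valuation', hπ]
  have hint : ∀ β : v.adicCompletionIntegers K, w (β : v.adicCompletion K) ≤ 1 := fun β ↦ β.2
  have hnat : ∀ n : ℕ, w (n : v.adicCompletion K) ≤ 1 := fun n ↦ by
    rw [← map_natCast (algebraMap K (v.adicCompletion K)) n]
    have : w (algebraMap K (v.adicCompletion K) n) = v.valuation K n :=
      valuedAdicCompletion_eq_valuation' v (n : K)
    rw [this, ← map_natCast (algebraMap A K) n]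
    exact v.valuation_le_one _
  have hunit : ∀ {β : v.adicCompletionIntegers K}, IsUnit β → w (β : v.adicCompletion K) = 1 := by
    intro β hβ
    obtain ⟨γ, hγ⟩ := hβ.exists_right_inv
    have h1 : w (β : v.adicCompletion K) * w (γ : v.adicCompletion K) = 1 := by
      rw [← map_mul, ← Subring.coe_mul, hγ]; simp
    refine le_antisymm (hint β) ?_
    calc (1 : ℤᵐ⁰) = w (β : v.adicCompletion K) * w (γ : v.adicCompletion K) := h1.symm
      _ ≤ w (β : v.adicCompletion K) * 1 := mul_le_mul' le_rfl (hint γ)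
      _ = _ := mul_one _
  -- the bracket and the factorisation `c₆ = ϖ^m · I`
  set I : v.adicCompletion K :=
    -(β₂ : v.adicCompletion K) ^ 3 + ϖ * (4 * β₂ * β₄) - ϖ ^ 2 * (8 * β₆) with hI
  have hc₆ : N.c₆ = ϖ ^ m * I := by
    have h36 : (36 : v.adicCompletion K) = 4 * ϖ ^ 2 := by rw [h3]; norm_num
    have h216 : (216 : v.adicCompletion K) = 8 * ϖ ^ 3 := by rw [h3]; norm_num
    rw [WeierstrassCurve.c₆, hb₂, hb₄, hb₆, h36, h216, hI]
    rcases hk with ⟨rfl, rfl, rfl, rfl⟩ | ⟨rfl, rfl, rfl, rfl⟩ <;> ring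
  -- valuation of the bracket: a unit, or in `ϖ²𝒪`
  have hI' : w I = 1 ∨ w I ≤ exp (-2 : ℤ) := by
    have h4 : w (4 : v.adicCompletion K) ≤ 1 := by exact_mod_cast hnat 4
    have h8 : w (8 : v.adicCompletion K) ≤ 1 := by exact_mod_cast hnat 8
    have hT3 : w (ϖ ^ 2 * (8 * β₆)) ≤ exp (-2 : ℤ) := by
      rw [map_mul, map_pow, hπv, map_mul, ← exp_nsmul]
      calc exp (2 • (-1 : ℤ)) * (w 8 * w (β₆ : v.adicCompletion K))
          ≤ exp (2 • (-1 : ℤ)) * (1 * 1) := mul_le_mul' le_rfl (mul_le_mul' h8 (hint β₆))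
        _ = exp (-2 : ℤ) := by simp
    rcases eq_or_lt_of_le (hint β₂) with hβ | hβ
    · -- `β₂` a unit: the bracket is a unit
      left
      have hcube : w (-(β₂ : v.adicCompletion K) ^ 3) = 1 := by
        rw [Valuation.map_neg, map_pow, hβ, one_pow]
      have hT2 : w (ϖ * (4 * β₂ * β₄)) ≤ exp (-1 : ℤ) := by
        rw [map_mul, hπv, map_mul, map_mul]
        calc exp (-1 : ℤ) * (w 4 * w (β₂ : v.adicCompletion K) * w (β₄ : v.adicCompletion K))
            ≤ exp (-1 : ℤ) * (1 * 1 * 1) :=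
              mul_le_mul' le_rfl (mul_le_mul' (mul_le_mul' h4 (hint β₂)) (hint β₄))
          _ = exp (-1 : ℤ) := by simp
      have hrest : w (ϖ * (4 * β₂ * β₄) - ϖ ^ 2 * (8 * β₆)) <
          w (-(β₂ : v.adicCompletion K) ^ 3) := by
        rw [hcube]
        refine lt_of_le_of_lt (Valuation.map_sub _ _ _) (max_lt ?_ ?_)
        · exact lt_of_le_of_lt hT2 (by rw [← exp_zero, exp_lt_exp]; norm_num)
        · exact lt_of_le_of_lt hT3 (by rw [← exp_zero, exp_lt_exp]; norm_num)
      have hsplit : I = -(β₂ : v.adicCompletion K) ^ 3 +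
          (ϖ * (4 * β₂ * β₄) - ϖ ^ 2 * (8 * β₆)) := by rw [hI]; ring
      rw [hsplit, w.map_add_eq_of_lt_left hrest, hcube]
    · -- `β₂ ∈ ϖ𝒪`: every term lies in `ϖ²𝒪`
      right
      have hβ' : w (β₂ : v.adicCompletion K) ≤ exp (-1 : ℤ) := le_exp_neg_one_of_lt_one hβ
      have hcube : w (-(β₂ : v.adicCompletion K) ^ 3) ≤ exp (-2 : ℤ) := by
        rw [Valuation.map_neg, map_pow]
        calc w (β₂ : v.adicCompletion K) ^ 3 ≤ exp (-1 : ℤ) ^ 3 := pow_le_pow_left' hβ' 3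
          _ ≤ exp (-2 : ℤ) := by rw [← exp_nsmul, exp_le_exp]; norm_num
      have hT2 : w (ϖ * (4 * β₂ * β₄)) ≤ exp (-2 : ℤ) := by
        rw [map_mul, hπv, map_mul, map_mul]
        calc exp (-1 : ℤ) * (w 4 * w (β₂ : v.adicCompletion K) * w (β₄ : v.adicCompletion K))
            ≤ exp (-1 : ℤ) * (1 * exp (-1 : ℤ) * 1) :=
              mul_le_mul' le_rfl (mul_le_mul' (mul_le_mul' h4 hβ') (hint β₄))
          _ = exp (-2 : ℤ) := by rw [one_mul, mul_one, ← exp_add]; norm_num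
      rw [hI]
      exact Valuation.map_sub_le _ (Valuation.map_add_le _ hcube hT2) hT3
  -- through `j − 1728 = c₆² / Δ`
  have hwΔ : w N.Δ = exp (-(e : ℤ)) := by
    rw [hΔ, map_mul, map_pow, hπv, hunit hδ, mul_one, ← exp_nsmul]
    simp
  have hj : w (N.j - 1728) = w N.c₆ ^ 2 * exp (e : ℤ) := by
    rw [j_sub_eq_c₆_sq_div_Δ_of_field N, map_div₀, map_pow, hwΔ, div_eq_mul_inv, ← exp_neg, neg_neg]
  have hwc₆ : w N.c₆ = exp (-(m : ℤ)) * w I := by rw [hc₆, map_mul, map_pow, hπv, ← exp_nsmul]; simp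
  rcases hI' with h1 | h2
  · left
    rw [hj, hwc₆, h1, mul_one, ← exp_nsmul, ← exp_add]
    congr 1
    simp only [nsmul_eq_mul]
    push_cast
    ring
  · right
    rw [hj, hwc₆]
    calc (exp (-(m : ℤ)) * w I) ^ 2 * exp (e : ℤ)
        ≤ (exp (-(m : ℤ)) * exp (-2 : ℤ)) ^ 2 * exp (e : ℤ) :=
          mul_le_mul' (pow_le_pow_left' (mul_le_mul' le_rfl h2) 2) le_rfl
      _ = exp ((e : ℤ) - 2 * m - 4) := by
          rw [← exp_add, ← exp_nsmul, ← exp_add]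
          congr 1
          simp only [nsmul_eq_mul]
          push_cast
          ring

end Local

/-! ## §2 The census gap `v₃(j − 1728) ∈ {3} ∪ [7, ∞)` for Kodaira `III` / `III*` at `3` -/

section Curves

/-- The rational prime below `placeOf 3` is `3`. [folklore] -/
private theorem natGenerator_placeOf_three : natGenerator (placeOf 3) = 3 :=
  Literature.NumberTheory.EllipticCurves.Rat.natGenerator_primesEquiv_symm ⟨3, Nat.prime_three⟩

/-- `ord_{(3)}(3) = 1`. [folklore] -/
private theorem valuation_placeOf_three_three :
    (placeOf 3).valuation ℚ (3 : ℚ) = exp (-1 : ℤ) := by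
  rw [valuation_eq_exp_neg_padicValRat (placeOf 3) three_ne_zero, natGenerator_placeOf_three,
    show (3 : ℚ) = ((3 : ℕ) : ℚ) by norm_num, padicValRat.self (by norm_num)]

variable (W : WeierstrassCurve ℚ) [W.IsElliptic]

/-- **Kodaira `III` or `III*` at `3` ⟹ `v₃(j − 1728) = 3` or `≥ 7`** (o5-r1's census gap
"never `4, 5, 6`", TABLE-FREE): Tate's Step-4 / Step-9 normal forms feed the bracket lemma
(`e − 2m = 3 − 6 = 9 − 12 = −3`), and `j` is an invariant of the model (`variableChange_j`).
[cite: SilvermanATAEC1994, IV.9.4 Steps 4 and 9, Table 4.1 (PDF pp. 344–346, 365)] -/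
theorem padicValRat_j_sub_eq_three_or_seven_le_of_kodairaSymbolAt_III_or_IIIstar
    (hT : W.kodairaSymbolAt (placeOf 3) = .III ∨ W.kodairaSymbolAt (placeOf 3) = .IIIstar)
    (hj : W.j ≠ 1728) :
    padicValRat 3 (W.j - 1728) = 3 ∨ 7 ≤ padicValRat 3 (W.j - 1728) := by
  haveI : PerfectField (IsLocalRing.ResidueField ((placeOf 3).adicCompletionIntegers ℚ)) :=
    PerfectField.ofFinite
  have h2 : ringChar (ℤ ⧸ (placeOf 3).asIdeal) ≠ 2 := by rw [ringChar_int_quot_placeOf 3]; decide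
  have hπ := valuation_placeOf_three_three
  have h3 : algebraMap ℚ ((placeOf 3).adicCompletion ℚ) 3 = 3 := map_ofNat _ 3
  -- `v(j − 1728)` on the completion, from the shapes
  have key : Valued.v (algebraMap ℚ ((placeOf 3).adicCompletion ℚ) (W.j - 1728)) = exp (-3 : ℤ) ∨
      Valued.v (algebraMap ℚ ((placeOf 3).adicCompletion ℚ) (W.j - 1728)) ≤ exp (-7 : ℤ) := by
    have hjN : ∀ C : VariableChange ((placeOf 3).adicCompletion ℚ),
        (C • W.baseChange ((placeOf 3).adicCompletion ℚ)).j - 1728 =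
          algebraMap ℚ ((placeOf 3).adicCompletion ℚ) (W.j - 1728) := by
      intro C
      rw [variableChange_j, map_sub, map_ofNat]
      congr 1
      exact W.map_j (algebraMap ℚ _)
    have fin : ∀ {x : ℤᵐ⁰} {e m : ℕ}, (e : ℤ) - 2 * m = -3 →
        (x = exp ((e : ℤ) - 2 * m) ∨ x ≤ exp ((e : ℤ) - 2 * m - 4)) →
        (x = exp (-3 : ℤ) ∨ x ≤ exp (-7 : ℤ)) := by
      intro x e m h hx; rwa [h, show (-3 : ℤ) - 4 = -7 by norm_num] at hx
    rcases hT with hT | hT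
    · obtain ⟨C, β₂, β₄, β₆, δ, hδ, hb₂, hb₄, hb₆, hΔ⟩ :=
        W.exists_variableChange_b_of_kodairaSymbolAt_eq_III (placeOf 3) h2 hT hπ
      have core := valued_j_sub_eq_or_le_of_b_shape (placeOf 3) hπ h3
        (C • W.baseChange ((placeOf 3).adicCompletion ℚ)) 3 β₂ β₄ β₆ δ hδ hb₂ hb₄ hb₆ hΔ
        (Or.inl ⟨rfl, rfl, rfl, rfl⟩)
      exact hjN C ▸ fin (by norm_num) core
    · obtain ⟨C, β₂, β₄, β₆, δ, hδ, hb₂, hb₄, hb₆, hΔ⟩ :=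
        W.exists_variableChange_b_of_kodairaSymbolAt_eq_IIIstar (placeOf 3) h2 hT hπ
      have core := valued_j_sub_eq_or_le_of_b_shape (placeOf 3) hπ h3
        (C • W.baseChange ((placeOf 3).adicCompletion ℚ)) 9 β₂ β₄ β₆ δ hδ hb₂ hb₄ hb₆ hΔ
        (Or.inr ⟨rfl, rfl, rfl, rfl⟩)
      exact hjN C ▸ fin (by norm_num) core
  -- back to `ℚ`
  have hcoe : Valued.v (algebraMap ℚ ((placeOf 3).adicCompletion ℚ) (W.j - 1728)) =
      (placeOf 3).valuation ℚ (W.j - 1728) := valuedAdicCompletion_eq_valuation' (placeOf 3) _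
  rw [hcoe, valuation_eq_exp_neg_padicValRat (placeOf 3) (sub_ne_zero.mpr hj),
    natGenerator_placeOf_three] at key
  rcases key with h | h
  · left; have := exp_injective h; omega
  · right; have := exp_le_exp.mp h; omega

variable [W.IsGloballyMinimal]

/-- `v₃(Δ_min) = 3` on type `III`, `= 9` on type `III*` at `3` (`ord Δ = m + 1`, the tree's
`ordMinimalDiscriminant_eq_numComponentsAt_add_one_of_kodairaSymbolAt`, read on the globally minimal
equation). [cite: SilvermanATAEC1994, Table 4.1 (PDF p. 365)] -/
theorem padicValRat_Δ_eq_of_kodairaSymbolAt_III_or_IIIstar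
    (hT : W.kodairaSymbolAt (placeOf 3) = .III ∨ W.kodairaSymbolAt (placeOf 3) = .IIIstar) :
    (W.kodairaSymbolAt (placeOf 3) = .III → padicValRat 3 W.Δ = 3) ∧
      (W.kodairaSymbolAt (placeOf 3) = .IIIstar → padicValRat 3 W.Δ = 9) := by
  haveI : PerfectField (IsLocalRing.ResidueField ((placeOf 3).adicCompletionIntegers ℚ)) :=
    PerfectField.ofFinite
  have h2 : ringChar (ℤ ⧸ (placeOf 3).asIdeal) ≠ 2 := by rw [ringChar_int_quot_placeOf 3]; decide
  have hord := W.ordMinimalDiscriminant_eq_numComponentsAt_add_one_of_kodairaSymbolAt (placeOf 3) h2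
    (hT.elim Or.inl fun h ↦ Or.inr (Or.inl h))
  rw [ordMinimalDiscriminant_placeOf_eq W 3] at hord
  have hv : padicValRat 3 W.Δ = (padicValInt 3 W.minimalDiscriminantInt : ℤ) :=
    padicValRat_Δ_eq_padicValInt_minimalDiscriminantInt W
  unfold numComponentsAt at hord
  constructor <;> intro h <;> rw [h] at hord <;>
    simp only [KodairaSymbol.numComponents] at hord <;> rw [hv, hord] <;> norm_num

omit [W.IsGloballyMinimal] in
/-- **The discriminant identity `c₄³ = c₆² + 1728Δ` read `3`-adically** (`v₃(1728) = 3`): with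
`a, b, c = v₃(c₄), v₃(c₆), v₃(Δ)` and `c₆ ≠ 0`: if `c₄ = 0` then `2b = c + 3`; if `c₄ ≠ 0` then
`2b < c + 3 ⟹ 3a = 2b`, `c + 3 < 2b ⟹ 3a = c + 3`, `2b = c + 3 ⟹ c + 3 ≤ 3a` (ultrametric
inequality, `padicValRat.add_eq_min` / `min_le_padicValRat_add`). [folklore] -/
theorem padicValRat_c_relation_three (hc6 : W.c₆ ≠ 0) :
    (W.c₄ = 0 → 2 * padicValRat 3 W.c₆ = padicValRat 3 W.Δ + 3) ∧
      (W.c₄ ≠ 0 →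
        (2 * padicValRat 3 W.c₆ < padicValRat 3 W.Δ + 3 →
            3 * padicValRat 3 W.c₄ = 2 * padicValRat 3 W.c₆) ∧
          (padicValRat 3 W.Δ + 3 < 2 * padicValRat 3 W.c₆ →
            3 * padicValRat 3 W.c₄ = padicValRat 3 W.Δ + 3) ∧
          (2 * padicValRat 3 W.c₆ = padicValRat 3 W.Δ + 3 →
            padicValRat 3 W.Δ + 3 ≤ 3 * padicValRat 3 W.c₄)) := by
  have hΔ : W.Δ ≠ 0 := by rw [← W.coe_Δ']; exact W.Δ'.ne_zero
  have h1728 : padicValRat 3 (1728 : ℚ) = 3 := by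
    rw [show (1728 : ℚ) = (3 : ℚ) ^ 3 * 64 by norm_num, padicValRat.mul (by norm_num) (by norm_num),
      padicValRat.pow, show (3 : ℚ) = ((3 : ℕ) : ℚ) by norm_num, padicValRat.self (by norm_num)]
    have h64 : padicValRat 3 (64 : ℚ) = 0 := by
      rw [show (64 : ℚ) = ((64 : ℕ) : ℚ) by norm_num, padicValRat.of_nat, Nat.cast_eq_zero]
      exact padicValNat.eq_zero_of_not_dvd (by norm_num)
    rw [h64]; norm_num
  have hrel : W.c₄ ^ 3 = W.c₆ ^ 2 + 1728 * W.Δ := by linear_combination -W.c_relation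
  have hsq : padicValRat 3 (W.c₆ ^ 2) = 2 * padicValRat 3 W.c₆ := by rw [padicValRat.pow]; rfl
  have hmul : padicValRat 3 (1728 * W.Δ) = padicValRat 3 W.Δ + 3 := by
    rw [padicValRat.mul (by norm_num) hΔ, h1728]; ring
  have hsq0 : W.c₆ ^ 2 ≠ 0 := pow_ne_zero 2 hc6
  have hmul0 : 1728 * W.Δ ≠ 0 := mul_ne_zero (by norm_num) hΔ
  refine ⟨fun hc4 ↦ ?_, fun hc4 ↦ ?_⟩
  · have h0 : W.c₆ ^ 2 = -(1728 * W.Δ) := by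
      have : W.c₆ ^ 2 + 1728 * W.Δ = 0 := by rw [← hrel, hc4]; ring
      linear_combination this
    have := congrArg (padicValRat 3) h0
    rw [hsq, padicValRat.neg, hmul] at this
    exact this
  · have hsum0 : W.c₆ ^ 2 + 1728 * W.Δ ≠ 0 := by rw [← hrel]; exact pow_ne_zero 3 hc4
    have hcube : padicValRat 3 (W.c₆ ^ 2 + 1728 * W.Δ) = 3 * padicValRat 3 W.c₄ := by
      rw [← hrel, padicValRat.pow]; push_cast; ring
    have hmin := padicValRat.min_le_padicValRat_add (p := 3) hsum0; rw [hsq, hmul, hcube] at hmin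
    refine ⟨fun hlt ↦ ?_, fun hlt ↦ ?_, fun heq ↦ ?_⟩
    · have h := padicValRat.add_eq_min (p := 3) hsum0 hsq0 hmul0 (by rw [hsq, hmul]; omega)
      rw [hsq, hmul, hcube] at h
      omega
    · have h := padicValRat.add_eq_min (p := 3) hsum0 hsq0 hmul0 (by rw [hsq, hmul]; omega)
      rw [hsq, hmul, hcube] at h
      omega
    · omega

/-! ## §3 The selector identity on (t′) at `3`, unconditionally -/

/-- **The selector identity on (t′) at `3` — UNCONDITIONAL.** For `W/ℚ` elliptic and globally minimal,
additive at `3` (`Addv W 3`), in the census cell (t′) (`SubTprime W 3`) and with `j ≠ 1728`: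
`E[3]|G_{ℚ₃}` is irreducible iff `7 ≤ v₃(j − 1728)`. Ingredients, all tree THEOREMS: (t′) ⟺ Kodaira
`III`/`III*` (`subTprime_three_iff_kodairaSymbolAt_III_or_IIIstar`, n1011-p14), the census gap of §2
(Tate's normal forms, bsd.S15), `v₃(Δ_min) ∈ {3, 9}`, the discriminant identity, and L-O56-sel
(`locIrrThreeIffCriterion_holds`, harvest-2). No table, no named fact. [folklore] -/
theorem locIrr_three_iff_seven_le_of_subTprime (hadd : Addv W 3) (hT : SubTprime W 3)
    (hj : W.j ≠ 1728) : LocIrr W 3 ↔ 7 ≤ padicValRat 3 (W.j - 1728) := by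
  have hK : W.kodairaSymbolAt (placeOf 3) = .III ∨ W.kodairaSymbolAt (placeOf 3) = .IIIstar :=
    (subTprime_three_iff_kodairaSymbolAt_III_or_IIIstar (W := W) hadd).mp hT
  have hgap := padicValRat_j_sub_eq_three_or_seven_le_of_kodairaSymbolAt_III_or_IIIstar W hK hj
  have hc6 : W.c₆ ≠ 0 := c₆_ne_zero_of_j_ne W hj
  have hvj := padicValRat_j_sub_eq W hc6
  have hΔ39 : padicValRat 3 W.Δ = 3 ∨ padicValRat 3 W.Δ = 9 := by
    have h := padicValRat_Δ_eq_of_kodairaSymbolAt_III_or_IIIstar W hK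
    exact hK.elim (fun h3 ↦ Or.inl (h.1 h3)) (fun h9 ↦ Or.inr (h.2 h9))
  obtain ⟨hz, hnz⟩ := padicValRat_c_relation_three W hc6
  rw [locIrrThreeIffCriterion_holds W]
  unfold LocIrrCriterionThree
  rw [hvj] at hgap ⊢
  by_cases hc4 : W.c₄ = 0
  · have h := hz hc4
    constructor
    · rintro ⟨h4, -⟩; exact absurd hc4 h4
    · intro h7; omega
  · obtain ⟨hlt, hgt, heq⟩ := hnz hc4
    constructor
    · rintro ⟨-, h0 | hle⟩
      · exact absurd h0 hc6
      · by_contra h7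
        have h3 : 2 * padicValRat 3 W.c₆ - padicValRat 3 W.Δ = 3 := by omega
        have := heq (by omega)
        omega
    · intro h7
      have := hgt (by omega)
      exact ⟨hc4, Or.inr (by omega)⟩

/-- **`SelectorIdentityTameThree` IS A THEOREM** (cc-typer-5's TARGET in
`Additive/LocIrrValuationCriterionThree.lean`, binders verbatim): for every elliptic, globally minimal
`W/ℚ` with `ClassO5 W 3`, `SubTprime W 3`, `j ≠ 1728`: `LocIrr W 3 ↔ 7 ≤ v₃(j − 1728)`.
`ClassO5` supplies `Addv W 3`; the rest is `locIrr_three_iff_seven_le_of_subTprime`. The Table II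
binder of `selectorIdentityTameThree_of_tableII` (p297328) is thereby RETIRED for this identity (that
conditional form stays as landed). EVIDENCE 36 323 / 0 stays EVIDENCE; nothing booked; no mark.
[folklore] -/
theorem selectorIdentityTameThree_holds : SelectorIdentityTameThree :=
  fun W _ _ hO hT hj => locIrr_three_iff_seven_le_of_subTprime W hO.2.1 hT hj

end Curves

end Summit.BirchSwinnertonDyer.Rank1Residual.Additive

end
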